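/-
Copyright (c) 2026 the pub-hodgecm-mathlib formalisation cell (harness21).  Prover seat hodgecm-mathlib-K2E5-p16 (g5): Track B «K2-LIT»,
hLiu418 = stmt-HodgeConjecture-24832, ROAD Φ organ Φ6b-6 (β-shift of Shimura's `η` on `Herm₂(ℂ)`), bonus file: the CENTRE VALUE
`etaShift(g, h; 2, 1) = π e^{−tr(hg)} ∕ det g` (LEAD rider (R3): «the centre value … is exactly what the Hol∕Φ6b-res side reads»); 2026-09-04.
-/
import Summits.HodgeConjecture.HodgeConjecture.Theorems.K2LiuHermTwoEtaBetaShift              -- ★ p858438: translated shifted objects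
import Summits.HodgeConjecture.HodgeConjecture.Theorems.K2LiuHermTwoSiegelGindikinFibres       -- ★ p857667: `integral_Ioi_comp_add`
import Mathlib.Analysis.SpecialFunctions.ImproperIntegrals
import HarnessLib

/-!
# Crux `HLiu418`, ROAD Φ, organ Φ6b-6 — bonus: the centre value `etaShift(g, h; 2, 1) = π · e^{−tr(hg)} ∕ det g`

Cell `hodgecm-mathlib`, crux item hLiu418 = `stmt-HodgeConjecture-24832`, route of record `HCCMUnconditional`; squad K2, LEAD F0P6-plan (g12∕g13)
(rider (R3) 2026-09-04 07:40:27Z: «BONUS YES but LAST … one short file after (5)»), co-dealer K2E5-plan (g6), prover K2E5-p16 (g5).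
THEOREMS ONLY; lane `--supports stmt-HodgeConjecture-24832 --as helper`.

WHAT.  At the centre `s₀ = ½` of the arch diagonal `(α, β) = (s + 3∕2, s + ½)` one has `(α, β) = (2, 1)`: the weight is `Q_2 = g₀₀ ∕ (x − h)₁₁`
(the `(α − 2)`-term vanishes) and both determinant powers are `det^0 = 1`, so
  `etaShift(g, h; 2, 1) = ∫_{x > h} g₀₀ (x − h)₁₁⁻¹ e^{−tr(gx)} dx = g₀₀ e^{−tr(gh)} ∫_{u > 0} u₁₁⁻¹ e^{−tr(gu)} du = π · e^{−tr(gh)} ∕ det g`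
(`etaShift_two_one`), because (the `t`-trick of ★ (M1), now with the VALUE) `∫_{u>0} u₁₁⁻¹ e^{−tr(yu)} du = ∫₀^∞ Γ₂(2) det(y + tE₁₁)^{−2} dt =
π ∫₀^∞ (det y + y₀₀ t)^{−2} dt = π ∕ (y₀₀ det y)` (`integral_inv_snd_mul_exp`).  Since `(β − 1)Γ₂(β)η = π Γ(β)² · Γ₂(β)⁻¹ … `, this is the
value `Γ₂(β)⁻¹ η(g, h; 2, β)|_{β = 1} = etaShift(g, h; 2, 1) ∕ π = e^{−tr(gh)} ∕ det g` of the arch coefficient at the centre.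
HONEST LABEL.  Count-neutral helper of the K2_Liu road; it pays no socket by itself: `HC_CM` is proved only modulo the 7 printed citations
(2 remaining named inputs: hLiu418 = `stmt-HodgeConjecture-24832`, h413 = `stmt-HodgeConjecture-24833`) until rung 0 closes.
-/

set_option autoImplicit false
-- the mandated namespace repeats the single-problem summit's segment (`HodgeConjecture.HodgeConjecture`)
set_option linter.dupNamespace false

noncomputable section

open Complex MeasureTheory Set
open scoped ComplexOrder ComplexConjugate ENNReal

namespace Summit.HodgeConjecture.HodgeConjecture.Cruxes.HLiu418.K2LiuHermTwoEtaShiftCentreValue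

open Summit.HodgeConjecture.HodgeConjecture.Cruxes.HLiu418.K2LiuHermTwoGammaDefs
open Summit.HodgeConjecture.HodgeConjecture.Cruxes.HLiu418.K2LiuHermTwoGammaSiegelGindikin
open Summit.HodgeConjecture.HodgeConjecture.Cruxes.HLiu418.K2LiuHermTwoSiegelGindikinFibres
open Summit.HodgeConjecture.HodgeConjecture.Cruxes.HLiu418.K2LiuHermTwoEtaDefs
open Summit.HodgeConjecture.HodgeConjecture.Cruxes.HLiu418.K2LiuHermTwoEtaConvergence
open Summit.HodgeConjecture.HodgeConjecture.Cruxes.HLiu418.K2LiuHermTwoEtaGrowth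
open Summit.HodgeConjecture.HodgeConjecture.Cruxes.HLiu418.K2LiuHermTwoConeInvEntryIntegrable
open Summit.HodgeConjecture.HodgeConjecture.Cruxes.HLiu418.K2LiuHermTwoEtaShiftDefs
open Summit.HodgeConjecture.HodgeConjecture.Cruxes.HLiu418.K2LiuHermTwoEtaShiftConvergence
open Summit.HodgeConjecture.HodgeConjecture.Cruxes.HLiu418.K2LiuHermTwoEtaBetaShift

/-! ## The last `t`-integral: `∫₀^∞ (D + p t)^{−2} dt = 1∕(p D)` -/

/-- Translation invariance on a half-line, real-valued: `∫_{(0,∞)} g(t + m) dt = ∫_{(m,∞)} g(b) db`. -/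
theorem integral_Ioi_comp_add_real (g : ℝ → ℝ) (m : ℝ) : ∫ t in Ioi (0 : ℝ), g (t + m) = ∫ b in Ioi m, g b := by
  rw [← integral_indicator measurableSet_Ioi, ← integral_indicator measurableSet_Ioi]
  have h : (Ioi (0 : ℝ)).indicator (fun t => g (t + m)) = fun t => (Ioi m).indicator g (t + m) := by
    funext t
    by_cases ht : t ∈ Ioi (0 : ℝ)
    · rw [indicator_of_mem ht, indicator_of_mem (show t + m ∈ Ioi m by simpa using ht)]
    · rw [indicator_of_notMem ht, indicator_of_notMem (show t + m ∉ Ioi m by simpa using ht)]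
  rw [h]
  exact integral_add_right_eq_self _ m

/-- For `D, p > 0`: `∫₀^∞ (D + p t)^{−2} dt = 1 ∕ (p D)`. -/
theorem integral_Ioi_add_mul_rpow_neg_two {D p : ℝ} (hD : 0 < D) (hp : 0 < p) :
    ∫ t in Ioi (0 : ℝ), (D + p * t) ^ (-(2 : ℝ)) = 1 / (p * D) := by
  have h1 : (fun t : ℝ => (D + p * t) ^ (-(2 : ℝ))) = fun t => (fun τ : ℝ => (τ + D) ^ (-(2 : ℝ))) (p * t) := by
    funext t
    simp only [add_comm D (p * t)]
  rw [h1, integral_comp_mul_left_Ioi (fun τ : ℝ => (τ + D) ^ (-(2 : ℝ))) 0 hp, mul_zero,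
    integral_Ioi_comp_add_real (fun τ : ℝ => τ ^ (-(2 : ℝ))) D, integral_Ioi_rpow_of_lt (by norm_num) hD, smul_eq_mul]
  rw [show (-(2 : ℝ) + 1) = -1 by norm_num, Real.rpow_neg_one]
  field_simp

/-! ## The weighted cone integral, with its value -/

/-- **THE WEIGHTED CONE INTEGRAL** (value form of ★ (M1) at `s = 2`): for `y = [[p, w],[w̄, q]] > 0`,
`∫_{u > 0} u₁₁⁻¹ e^{−tr(u y)} du = π ∕ (p · det y)` (`u₁₁ = b` in the chart `u = hermTwo (a, z, b)`). -/
theorem integral_inv_snd_mul_exp (d : ℝ × ℂ × ℝ) (hd : 0 < d.1 ∧ normSq d.2.1 < d.1 * d.2.2) :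
    ∫ c in {c : ℝ × ℂ × ℝ | (hermTwo c).PosDef}, c.2.2⁻¹ * Real.exp (-(c.1 * d.1 + c.2.2 * d.2.2 + 2 * (c.2.1 * conj d.2.1).re)) =
      Real.pi / (d.1 * (d.1 * d.2.2 - normSq d.2.1)) := by
  have hD : 0 < d.1 * d.2.2 - normSq d.2.1 := by linarith [hd.2]
  set S : Set (ℝ × ℂ × ℝ) := {c : ℝ × ℂ × ℝ | (hermTwo c).PosDef} with hSdef
  have hSm : MeasurableSet S := measurableSet_posDef_hermTwo
  set E : ℝ × ℂ × ℝ → ℝ := fun c => Real.exp (-(c.1 * d.1 + c.2.2 * d.2.2 + 2 * (c.2.1 * conj d.2.1).re)) with hEdef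
  have hEm : Measurable E := by
    have h := measurable_siegelGindikin_real d 2
    have hf : (fun c : ℝ × ℂ × ℝ => Real.exp (-(c.1 * d.1 + c.2.2 * d.2.2 + 2 * (c.2.1 * conj d.2.1).re)) * (c.1 * c.2.2 - normSq c.2.1) ^ ((2 : ℝ) - 2)) =
        E := by
      funext c
      rw [hEdef, show (2 : ℝ) - 2 = 0 by norm_num, Real.rpow_zero, mul_one]
    rw [← hf]
    exact h
  -- the function on the product `S × (0, ∞)`
  set F : (ℝ × ℂ × ℝ) × ℝ → ℝ := fun z => Real.exp (-(z.2 * z.1.2.2)) * E z.1 with hFdef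
  have hFm : Measurable F :=
    (Real.measurable_exp.comp ((measurable_snd.mul (measurable_snd.comp (measurable_snd.comp measurable_fst))).neg)).mul (hEm.comp measurable_fst)
  have hF0 : ∀ z, 0 ≤ F z := fun z => mul_nonneg (Real.exp_pos _).le (Real.exp_pos _).le
  -- (1) finiteness of the product lintegral (★ M1 at `s = 2`)
  have hM1 : IntegrableOn (fun c : ℝ × ℂ × ℝ => c.2.2⁻¹ * E c) S := by
    have h := integrableOn_inv_snd_mul_siegelGindikin d hd (s := 2) (by norm_num)
    refine h.congr_fun (fun c _ => ?_) hSm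
    simp only [hEdef, show (2 : ℝ) - 2 = (0 : ℝ) by norm_num, Real.rpow_zero, mul_one]
  have hinner : ∀ c ∈ S, ∫⁻ t in Ioi (0 : ℝ), ENNReal.ofReal (F (c, t)) = ENNReal.ofReal (c.2.2⁻¹ * E c) := by
    intro c hc
    have hc' := (posDef_hermTwo_iff c).mp hc
    have hb : 0 < c.2.2 := (mul_pos_iff_of_pos_left hc'.1).mp (lt_of_le_of_lt (normSq_nonneg _) hc'.2)
    simp only [hFdef]
    rw [← integral_exp_neg_mul_Ioi hb, ← integral_mul_const]
    exact (ofReal_integral_eq_lintegral_ofReal ((integrableOn_exp_neg_mul_Ioi hb).mul_const _)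
      (Filter.Eventually.of_forall fun t => mul_nonneg (Real.exp_pos _).le (Real.exp_pos _).le)).symm
  have hInt : Integrable F ((volume.restrict S).prod (volume.restrict (Ioi (0 : ℝ)))) := by
    refine ⟨hFm.aestronglyMeasurable, ?_⟩
    rw [hasFiniteIntegral_iff_ofReal (Filter.Eventually.of_forall hF0), lintegral_prod _ hFm.ennreal_ofReal.aemeasurable]
    have h1 : ∫⁻ c in S, ∫⁻ t in Ioi (0 : ℝ), ENNReal.ofReal (F (c, t)) = ∫⁻ c in S, ENNReal.ofReal (c.2.2⁻¹ * E c) :=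
      setLIntegral_congr_fun hSm hinner
    rw [h1]
    exact lt_of_le_of_lt (lintegral_mono fun c => Real.ofReal_le_enorm _) hM1.hasFiniteIntegral
  have hInt' : Integrable (Function.uncurry fun c t => F (c, t)) ((volume.restrict S).prod (volume.restrict (Ioi (0 : ℝ)))) := by
    have hu : (Function.uncurry fun c t => F (c, t)) = F := by
      funext z
      rfl
    rw [hu]
    exact hInt
  -- (2) `b⁻¹ E = ∫₀^∞ e^{−tb} E dt` on the cone, then swap the integrals
  have hleft : ∫ c in S, c.2.2⁻¹ * E c = ∫ c in S, ∫ t in Ioi (0 : ℝ), F (c, t) := by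
    refine setIntegral_congr_fun hSm fun c hc => ?_
    have hc' := (posDef_hermTwo_iff c).mp hc
    have hb : 0 < c.2.2 := (mul_pos_iff_of_pos_left hc'.1).mp (lt_of_le_of_lt (normSq_nonneg _) hc'.2)
    simp only [hFdef]
    rw [integral_mul_const, integral_exp_neg_mul_Ioi hb]
  rw [hleft, integral_integral_swap hInt']
  -- (3) the inner cone integral at fixed `t > 0` is Siegel–Gindikin at `y_t` with `s = 2`
  have hin : ∀ t ∈ Ioi (0 : ℝ), ∫ c in S, F (c, t) = Real.pi * (d.1 * d.2.2 - normSq d.2.1 + d.1 * t) ^ (-(2 : ℝ)) := by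
    intro t ht
    have hdt := posDef_chart_add hd (le_of_lt ht)
    have hI := integral_siegelGindikin_real (d.1, d.2.1, d.2.2 + t) hdt (s := 2) (by norm_num)
    rw [Real.Gamma_two, show (2 : ℝ) - 1 = 1 by norm_num, Real.Gamma_one, mul_one, mul_one] at hI
    have hval : (d.1, d.2.1, d.2.2 + t).1 * (d.1, d.2.1, d.2.2 + t).2.2 - normSq (d.1, d.2.1, d.2.2 + t).2.1 =
        d.1 * d.2.2 - normSq d.2.1 + d.1 * t := by
      simp only
      ring
    rw [hval] at hI
    rw [← hI]
    refine setIntegral_congr_fun hSm fun c _ => ?_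
    rw [siegelGindikin_real_chart_add d 2 t c, show (2 : ℝ) - 2 = 0 by norm_num, Real.rpow_zero, mul_one]
  rw [setIntegral_congr_fun measurableSet_Ioi hin, integral_const_mul, integral_Ioi_add_mul_rpow_neg_two hD hd.1]
  field_simp

/-! ## The centre value -/

/-- THE SHIFTED INTEGRAND AT `(α, β) = (2, 1)` on the `a`-fibre coordinates: for `u` in the cone and `g = hermTwo d`, `h = hermTwo e`,
`etaShiftIntegrand(g, h; 2, 1)(u + h) = g₀₀ · u₁₁⁻¹ · e^{−(τ(ug) + τ(hg))}` (both determinant powers are `det^0 = 1`). -/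
theorem etaShiftIntegrand_two_one_add (d e : ℝ × ℂ × ℝ) {u : ℝ × ℂ × ℝ} (hu : (hermTwo u).PosDef) :
    etaShiftIntegrand (hermTwo d) (hermTwo e) 2 1 (u + e) =
      (((d.1 * (u.2.2⁻¹ * Real.exp (-(u.1 * d.1 + u.2.2 * d.2.2 + 2 * (u.2.1 * conj d.2.1).re)))) *
        Real.exp (-(e.1 * d.1 + e.2.2 * d.2.2 + 2 * (e.2.1 * conj d.2.1).re)) : ℝ) : ℂ) := by
  have hu' := (posDef_hermTwo_iff u).mp hu
  have hb : 0 < u.2.2 := snd_pos_of_cone hu'.1 hu'.2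
  rw [etaShiftIntegrand_apply, etaShiftWeight_hermTwo, etaTwoIntegrand_add, trace_hermTwo_mul_hermTwo, hermTwo_apply_zero_zero,
    show (2 : ℂ) - 2 = 0 by norm_num, show (1 : ℂ) + 1 - 2 = 0 by norm_num, cpow_zero, cpow_zero, mul_one, mul_one, zero_mul, sub_zero]
  have h1 : (((u + e).2.2 - e.2.2 : ℝ) : ℂ) = (u.2.2 : ℂ) := by
    simp only [Prod.snd_add]
    push_cast
    ring
  have hT : (u + e).1 * d.1 + (u + e).2.2 * d.2.2 + 2 * ((u + e).2.1 * conj d.2.1).re =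
      (u.1 * d.1 + u.2.2 * d.2.2 + 2 * (u.2.1 * conj d.2.1).re) + (e.1 * d.1 + e.2.2 * d.2.2 + 2 * (e.2.1 * conj d.2.1).re) := by
    simp only [Prod.fst_add, Prod.snd_add, add_mul, Complex.add_re]
    ring
  rw [h1, hT]
  have hb0 : (u.2.2 : ℂ) ≠ 0 := ofReal_ne_zero.mpr hb.ne'
  push_cast
  rw [neg_add, Complex.exp_add]
  field_simp

/-- **THE CENTRE VALUE** (LEAD rider (R3)): for positive definite `g, h`,
`etaShift(g, h; 2, 1) = π · e^{−tr(hg)} ∕ det g`; equivalently `Γ₂(β)⁻¹ η(g, h; 2, β)|_{β=1} = etaShift(g, h; 2, 1)∕π = e^{−tr(hg)}∕det g`,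
the arch coefficient of #41 at the centre `s₀ = ½` of the diagonal `(s + 3∕2, s + ½)`. -/
theorem etaShift_two_one {g h : Matrix (Fin 2) (Fin 2) ℂ} (hg : g.PosDef) (hh : h.PosDef) :
    etaShift g h 2 1 = (Real.pi : ℂ) * cexp (-(h * g).trace) / g.det := by
  obtain ⟨d, rfl⟩ : ∃ d : ℝ × ℂ × ℝ, hermTwo d = g := ⟨_, hermTwo_eq_of_isHermitian hg.1⟩
  obtain ⟨e, rfl⟩ : ∃ e : ℝ × ℂ × ℝ, hermTwo e = h := ⟨_, hermTwo_eq_of_isHermitian hh.1⟩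
  have hd := (posDef_hermTwo_iff d).mp hg
  have hD : 0 < d.1 * d.2.2 - normSq d.2.1 := by linarith [hd.2]
  rw [etaShift_eq_integral_comp_add (hermTwo d) hh.posSemidef]
  rw [setIntegral_congr_fun measurableSet_posDef_hermTwo fun u hu => etaShiftIntegrand_two_one_add d e hu, integral_complex_ofReal,
    integral_mul_const, integral_const_mul, integral_inv_snd_mul_exp d hd, trace_hermTwo_mul_hermTwo, det_hermTwo, ← Complex.ofReal_neg,
    ← Complex.ofReal_exp]
  have hp : (d.1 : ℂ) ≠ 0 := ofReal_ne_zero.mpr hd.1.ne'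
  have hDc : ((d.1 * d.2.2 - normSq d.2.1 : ℝ) : ℂ) ≠ 0 := ofReal_ne_zero.mpr hD.ne'
  push_cast
  field_simp

end Summit.HodgeConjecture.HodgeConjecture.Cruxes.HLiu418.K2LiuHermTwoEtaShiftCentreValue

end
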